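import Summits.Parity.BatemanHorn.Theorems.AlmostPrimeZerosDiscMajorantLogGrowingDiscLinear
import Summits.Parity.BatemanHorn.Theorems.AlmostPrimeZerosDiscMajorantLogPoissonTailOfRealAxisGrowing

/-!
# Crux `DiscMajorantLog` (stmt-Parity-17114), line `Sketch`: Hardy–Ramanujan at Poisson precision up to
`m ≍ (log log x)²` for every linear system — unconditionally (stub `stub_poissonTailLinearClass`)

Support file for the registered skeleton `Cruxes/DiscMajorantLog/Lines/Sketch.lean` (rev 7).  The crux's complete
classical class `k = 1`, `deg = 1` (every Bateman–Horn system `(aX + b)`) is LANDED on the whole growing disc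
(`discMajorantLog_of_linear`, p150865: Selberg–Delange with radius `3 log log x` and its Dirichlet-character twin);
composing its positive real segment with the landed necessity stub `stub_poissonTailOfRealAxisGrowing` (p164355)
gives, with no hypothesis left,

  `#{n ≤ x : m ≤ s(an+b)} ≤ A · x · e^{−L} (e L / m)^m · e^{C (t−1) log((t−1)+2)}`,  `L ≤ m ≤ (1+3L) L`, `t = m/L`,

`L = log log x`, `s(N) = Σ_{p^v ∥ N} min(v,2)`: the Poisson(`L`) tail at factorial precision (up to `√(2πm)` and the
Γ-budget) in the range `m ≤ 3(log log x)² + log log x`.  For `f = X` this is a weak form of the Hardy–Ramanujan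
inequality (true for all `m`); its role here is to show on the one proven cell what the open stub `stub_realAxisGrowing`
asserts for every system.  Pure composition; the two bookkeeping lemmas (real points of the disc) are proved locally.
-/

noncomputable section

namespace Summit.Parity.BatemanHorn.Cruxes.DiscMajorantLog.Sketch

open scoped BigOperators

namespace PoissonTailLinear

/-- On the positive real axis the statistic is a sum of nonnegative reals: for `t ≥ 0`,
`‖Σ_n (t:ℂ)^{e n}‖ = Σ_n t^{e n}`. [folklore] -/
theorem norm_sum_ofReal_pow (t : ℝ) (ht : 0 ≤ t) (s : Finset ℕ) (e : ℕ → ℕ) :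
    ‖∑ n ∈ s, ((t : ℂ)) ^ (e n)‖ = ∑ n ∈ s, t ^ (e n) := by
  have h : (∑ n ∈ s, ((t : ℂ)) ^ (e n)) = ((∑ n ∈ s, t ^ (e n) : ℝ) : ℂ) := by push_cast; rfl
  rw [h, Complex.norm_real, Real.norm_eq_abs,
    abs_of_nonneg (Finset.sum_nonneg fun n _ => pow_nonneg ht _)]

/-- At a real point `z = t ≥ 1` of the disc: `‖(t:ℂ) − 1‖ = t − 1`. [folklore] -/
theorem norm_ofReal_sub_one {t : ℝ} (ht : 1 ≤ t) : ‖((t : ℝ) : ℂ) - 1‖ = t - 1 := by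
  rw [show ((t : ℝ) : ℂ) - 1 = ((t - 1 : ℝ) : ℂ) by push_cast; ring, Complex.norm_real, Real.norm_eq_abs,
    abs_of_nonneg (by linarith)]

/-- The real segment of a disc majorant: from the complex bound on `‖z − 1‖ ≤ 3 log log x` to the bound for real
`t ≥ 1`, `t − 1 ≤ 3 log log x`, in the shape consumed by `stub_poissonTailOfRealAxisGrowing` (`T₀ = 1`). [folklore] -/
theorem realSegment_of_disc {k : ℕ} (e : ℕ → ℕ) {A C : ℝ} {x₀ : ℕ}
    (h : ∀ x : ℕ, x₀ ≤ x → ∀ z : ℂ, ‖z - 1‖ ≤ 3 * Real.log (Real.log (x : ℝ)) →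
      ‖(∑ n ∈ Finset.range (x + 1), (z : ℂ) ^ (e n))‖ ≤
        A * (x : ℝ) * (Real.log (x : ℝ)) ^ ((k : ℝ) * ((z : ℂ).re - 1)) *
          Real.exp (C * ‖(z : ℂ) - 1‖ * Real.log (‖(z : ℂ) - 1‖ + 2))) :
    ∀ x : ℕ, x₀ ≤ x → ∀ t : ℝ, 1 ≤ t → t - 1 ≤ 3 * Real.log (Real.log (x : ℝ)) →
      (∑ n ∈ Finset.range (x + 1), t ^ (e n)) ≤
        A * (x : ℝ) * (Real.log (x : ℝ)) ^ ((k : ℝ) * (t - 1)) *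
          Real.exp (C * (t - 1) * Real.log ((t - 1) + 2)) := by
  intro x hx t ht1 ht3
  have hn : ‖((t : ℝ) : ℂ) - 1‖ = t - 1 := norm_ofReal_sub_one ht1
  have hz : ‖((t : ℝ) : ℂ) - 1‖ ≤ 3 * Real.log (Real.log (x : ℝ)) := by rw [hn]; exact ht3
  have h1 := h x hx (t : ℂ) hz
  rw [norm_sum_ofReal_pow t (by linarith) _ _, hn, Complex.ofReal_re] at h1
  exact h1

end PoissonTailLinear

/-- **Stub `stub_poissonTailLinearClass` (Hardy–Ramanujan at Poisson precision up to `m ≍ (log log x)²`, every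
linear Bateman–Horn system, unconditional).**  For every system with `k = 1`, `deg = 1` there are `A, C, x₀` with
`#{n ≤ x : m ≤ s_f(n)} ≤ A·x·e^{−L}·(e L/m)^m·exp(C (m/L − 1) log((m/L − 1) + 2))` for all `x ≥ x₀` with `log x > 1`
and all `L ≤ m ≤ (1+3L)·L`, `L = log log x`.  Composition of the landed cell `discMajorantLog_of_linear` (p150865,
its real segment) with the landed necessity stub `stub_poissonTailOfRealAxisGrowing` (p164355). [folklore] -/
theorem stub_poissonTailLinearClass :
    ∀ (k : ℕ) (f : Fin k → Polynomial ℤ), Literature.NumberTheory.Sieve.IsBatemanHornSystem f →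
      k = 1 → (∀ i, (f i).natDegree = 1) →
      ∃ A C : ℝ, ∃ x₀ : ℕ, ∀ x : ℕ, x₀ ≤ x → 1 < Real.log (x : ℝ) →
        ∀ m : ℕ, (k : ℝ) * Real.log (Real.log (x : ℝ)) ≤ m →
          (m : ℝ) ≤ (1 + 3 * Real.log (Real.log (x : ℝ))) * ((k : ℝ) * Real.log (Real.log (x : ℝ))) →
          ((((Finset.range (x + 1)).filter (fun n : ℕ =>
              m ≤ ∑ i, (((f i).eval (n : ℤ)).toNat.factorization.sum fun _ v => min v 2))).card : ℕ) : ℝ) ≤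
            A * (x : ℝ) * Real.exp (-((k : ℝ) * Real.log (Real.log (x : ℝ)))) *
              (Real.exp 1 * ((k : ℝ) * Real.log (Real.log (x : ℝ))) / m) ^ m *
              Real.exp (C * ((m : ℝ) / ((k : ℝ) * Real.log (Real.log (x : ℝ))) - 1) *
                Real.log (((m : ℝ) / ((k : ℝ) * Real.log (Real.log (x : ℝ))) - 1) + 2)) := by
  intro k f hf hk hdeg
  obtain ⟨A, C, x₀, h⟩ := discMajorantLog_of_linear k f hf hk hdeg
  refine ⟨A, C, x₀, fun x hx hlog m hm1 hm2 => ?_⟩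
  have hreal := PoissonTailLinear.realSegment_of_disc (k := k)
    (fun n : ℕ => ∑ i, (((f i).eval (n : ℤ)).toNat.factorization.sum fun _ v => min v 2)) h
  have hk1 : 1 ≤ k := by omega
  exact stub_poissonTailOfRealAxisGrowing k f 1 A C x₀ hk1 le_rfl hreal x hx hlog m (by simpa using hm1) hm2

end Summit.Parity.BatemanHorn.Cruxes.DiscMajorantLog.Sketch

end
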